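import Summits.Ventures.PercRepro.C026HubAttachE

/-!
# Hub attachment and the D-free inequality, VI: weights, the join decomposition, the table (p5, gen 10)

The (★)-slack of a marked multigraph is `Σ_{ω ∈ bot} ([O1] + [O2] − [a ~_H b])` (`starWeight`); the
frozen D-free inequality says this sum over the `F`-frozen configurations is nonnegative
(`dFreeFrozen_iff_sum`).  A configuration is the join `β ⊔ σ` of its base (hub edges closed) and its
hub part (`sum_frozen_eq_sum_join`), and on a `bot` base `β` with a single-direction hub part `σ` the
weight is the TABLE `tbl` of the signature bits of `σ` and the five base events of `β`
(`starWeight_join`; mine-3's 7 × 8 table in event form, from `hConn_ab_iff` / `hConnAvoid_ca_iff` /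
`hConnAvoid_cb_iff`).  The per-base inequality (`sum_starWeight_join_ge`) then follows from the two
counting facts `N₀₀₁ ≤ N₁₀₀`, `N₀₀₁ ≤ N₀₁₀` (the link configurations inject into the `SigA`
configurations and into the `SigB` configurations; proved in `C026HubAttachH.lean` and taken as
hypotheses here) and the Boolean inequality `g₀₀₁ + g₁₀₀ + g₀₁₀ ≥ g₀₀₀` (`decide`).
-/

namespace PercRepro

namespace MultiGraph

variable {V E : Type*} {G : MultiGraph V E}

/-! ### The (★)-weight and the frozen inequality as a sum -/

section Weight

variable (G) [Fintype E] [DecidableEq E]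

open Classical in
/-- **The (★)-weight** of a configuration: `[O1] + [O2] − [a ~_H b]` on `bot`, `0` otherwise. -/
noncomputable def starWeight (a b c : V) (ω : Config E) : ℤ :=
  if G.IsBot ω a b c then
    (if G.HConnAvoid ω c (G.cluster ω b) c a then 1 else 0) +
      (if G.HConnAvoid ω c (G.cluster ω a) c b then 1 else 0) -
        (if G.HConn ω c a b then 1 else 0)
  else 0

open Classical in
/-- **The frozen D-free inequality is the nonnegativity of the (★)-slack** over the `F`-frozen
configurations. -/
theorem dFreeFrozen_iff_sum (F : Set E) (a b c : V) :
    G.DFreeFrozen F a b c ↔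
      0 ≤ ∑ ω ∈ Finset.univ.filter (fun ω : Config E => Frozen F ω), G.starWeight a b c ω := by
  unfold DFreeFrozen starWeight
  rw [← Finset.sum_filter, Finset.filter_filter, Finset.sum_sub_distrib, Finset.sum_add_distrib,
    Finset.sum_boole, Finset.sum_boole, Finset.sum_boole, Finset.filter_filter, Finset.filter_filter,
    Finset.filter_filter]
  simp only [and_assoc]
  omega

end Weight

/-! ### Base and hub part -/

section Join

/-- The join of two configurations (pointwise `or`). -/
def _root_.PercRepro.join (β σ : Config E) : Config E := fun e => β e || σ e

variable (G)

open Classical in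
/-- The hub part of a configuration: `ω` on the hub edges, closed elsewhere. -/
noncomputable def hubOf (Hs : Set V) (ω : Config E) : Config E :=
  fun e => if e ∈ G.edgesAt Hs then ω e else false

/-- A configuration supported on the hub edges. -/
def HubOnly (Hs : Set V) (σ : Config E) : Prop := ∀ e, e ∉ G.edgesAt Hs → σ e = false

variable {G}

/-- The hub part is supported on the hub edges. -/
theorem hubOnly_hubOf (Hs : Set V) (ω : Config E) : G.HubOnly Hs (G.hubOf Hs ω) := by
  intro e he
  simp [hubOf, he]

/-- A configuration is the join of its base and its hub part. -/
theorem join_baseOf_hubOf (Hs : Set V) (ω : Config E) :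
    join (G.baseOf Hs ω) (G.hubOf Hs ω) = ω := by
  funext e
  by_cases he : e ∈ G.edgesAt Hs
  · simp [join, baseOf, hubOf, he]
  · simp [join, baseOf, hubOf, he]

/-- The join on a hub edge is the hub part. -/
theorem join_apply_of_mem {Hs : Set V} {β : Config E} (hβ : Frozen (G.edgesAt Hs) β) (σ : Config E)
    {e : E} (he : e ∈ G.edgesAt Hs) : join β σ e = σ e := by
  simp [join, hβ e he]

/-- The join off the hub edges is the base. -/
theorem join_apply_of_notMem {Hs : Set V} (β : Config E) {σ : Config E} (hσ : G.HubOnly Hs σ)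
    {e : E} (he : e ∉ G.edgesAt Hs) : join β σ e = β e := by
  simp [join, hσ e he]

/-- The base of a join is the base. -/
theorem baseOf_join {Hs : Set V} {β σ : Config E} (hβ : Frozen (G.edgesAt Hs) β)
    (hσ : G.HubOnly Hs σ) : G.baseOf Hs (join β σ) = β := by
  funext e
  by_cases he : e ∈ G.edgesAt Hs
  · rw [baseOf_apply_of_mem _ he, hβ e he]
  · rw [baseOf_apply_of_notMem _ he, join_apply_of_notMem β hσ he]

/-- The hub part of a join is the hub part. -/
theorem hubOf_join {Hs : Set V} {β σ : Config E} (hβ : Frozen (G.edgesAt Hs) β)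
    (hσ : G.HubOnly Hs σ) : G.hubOf Hs (join β σ) = σ := by
  funext e
  by_cases he : e ∈ G.edgesAt Hs
  · simp only [hubOf, he, if_true]
    exact join_apply_of_mem hβ σ he
  · simp only [hubOf, he, if_false]
    exact (hσ e he).symm

/-- Freezing survives the join with a hub part, for `F` disjoint from the hub edges. -/
theorem frozen_join {Hs : Set V} {F : Set E} (hdisj : ∀ e ∈ F, e ∉ G.edgesAt Hs) {β σ : Config E}
    (hβ : Frozen F β) (hσ : G.HubOnly Hs σ) : Frozen F (join β σ) := by
  intro e he
  rw [join_apply_of_notMem β hσ (hdisj e he)]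
  exact hβ e he

/-- The base is frozen on `F`. -/
theorem frozen_baseOf' {Hs : Set V} {F : Set E} {ω : Config E} (hF : Frozen F ω) :
    Frozen F (G.baseOf Hs ω) := frozen_baseOf_of_frozen hF

variable [Fintype E] [DecidableEq E]

open Classical in
/-- **The sum over the `F`-frozen configurations is a double sum over (base, hub part).** -/
theorem sum_frozen_eq_sum_join (Hs : Set V) {F : Set E} (hdisj : ∀ e ∈ F, e ∉ G.edgesAt Hs)
    (f : Config E → ℤ) :
    ∑ ω ∈ Finset.univ.filter (fun ω : Config E => Frozen F ω), f ω =
      ∑ β ∈ Finset.univ.filter (fun β : Config E => Frozen F β ∧ Frozen (G.edgesAt Hs) β),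
        ∑ σ ∈ Finset.univ.filter (fun σ : Config E => G.HubOnly Hs σ), f (join β σ) := by
  rw [← Finset.sum_product']
  refine Finset.sum_nbij' (fun ω => (G.baseOf Hs ω, G.hubOf Hs ω)) (fun p => join p.1 p.2) ?_ ?_ ?_
    ?_ ?_
  · intro ω hω
    simp only [Finset.mem_filter, Finset.mem_univ, true_and] at hω
    simp only [Finset.mem_product, Finset.mem_filter, Finset.mem_univ, true_and]
    exact ⟨⟨frozen_baseOf' hω, frozen_baseOf Hs ω⟩, hubOnly_hubOf Hs ω⟩
  · intro p hp
    simp only [Finset.mem_product, Finset.mem_filter, Finset.mem_univ, true_and] at hp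
    simp only [Finset.mem_filter, Finset.mem_univ, true_and]
    exact frozen_join hdisj hp.1.1 hp.2
  · intro ω _
    exact join_baseOf_hubOf Hs ω
  · intro p hp
    simp only [Finset.mem_product, Finset.mem_filter, Finset.mem_univ, true_and] at hp
    exact Prod.ext (baseOf_join hp.1.2 hp.2) (hubOf_join hp.1.2 hp.2)
  · intro ω _
    simp only [join_baseOf_hubOf]

end Join

/-! ### Hub states are read on the hub part -/

section Transfer

variable {Hs : Set V} {a b c : V} {β σ : Config E}

/-- An edge at a hub is a hub edge. -/
theorem mem_edgesAt_of_link_hub {h y : V} (hh : h ∈ Hs) {e : E} (hl : G.Link e h y) :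
    e ∈ G.edgesAt Hs := (hl.mem_edgesAt_iff Hs).2 (Or.inl hh)

variable (hβ : Frozen (G.edgesAt Hs) β)
include hβ

/-- `OpenTo` at a hub is read on the hub part. -/
theorem openTo_join_iff {h : V} (hh : h ∈ Hs) (y : V) :
    G.OpenTo (join β σ) h y ↔ G.OpenTo σ h y := by
  constructor
  · rintro ⟨e, he, hl⟩
    rw [join_apply_of_mem hβ σ (mem_edgesAt_of_link_hub hh hl)] at he
    exact ⟨e, he, hl⟩
  · rintro ⟨e, he, hl⟩
    refine ⟨e, ?_, hl⟩
    rw [join_apply_of_mem hβ σ (mem_edgesAt_of_link_hub hh hl)]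
    exact he

/-- `ClosedTo` at a hub is read on the hub part. -/
theorem closedTo_join_iff {h : V} (hh : h ∈ Hs) (y : V) :
    G.ClosedTo (join β σ) h y ↔ G.ClosedTo σ h y := by
  constructor
  · rintro ⟨e, he, hl⟩
    rw [join_apply_of_mem hβ σ (mem_edgesAt_of_link_hub hh hl)] at he
    exact ⟨e, he, hl⟩
  · rintro ⟨e, he, hl⟩
    refine ⟨e, ?_, hl⟩
    rw [join_apply_of_mem hβ σ (mem_edgesAt_of_link_hub hh hl)]
    exact he

/-- `SigM` is read on the hub part. -/
theorem sigM_join_iff (X : Set V) (m : V) :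
    G.SigM Hs X (join β σ) m c ↔ G.SigM Hs X σ m c := by
  unfold SigM
  constructor
  · rintro ⟨h, hh, hX, hcase⟩
    refine ⟨h, hh, hX, ?_⟩
    simp only [openTo_join_iff hβ hh, closedTo_join_iff hβ hh] at hcase
    exact hcase
  · rintro ⟨h, hh, hX, hcase⟩
    refine ⟨h, hh, hX, ?_⟩
    simp only [openTo_join_iff hβ hh, closedTo_join_iff hβ hh]
    exact hcase

/-- `SigLink` is read on the hub part. -/
theorem sigLink_join_iff (X : Set V) :
    G.SigLink Hs X (join β σ) a b c ↔ G.SigLink Hs X σ a b c := by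
  unfold SigLink
  constructor
  · rintro ⟨h, hh, hX, h1, h2, h3⟩
    simp only [openTo_join_iff hβ hh, closedTo_join_iff hβ hh] at h1 h2
    exact ⟨h, hh, hX, h1, h2, h3⟩
  · rintro ⟨h, hh, hX, h1, h2, h3⟩
    refine ⟨h, hh, hX, ?_, ?_, h3⟩
    · rwa [openTo_join_iff hβ hh]
    · rwa [closedTo_join_iff hβ hh]

/-- `SingleDir` is read on the hub part. -/
theorem singleDir_join_iff :
    G.SingleDir Hs a b c (join β σ) ↔ G.SingleDir Hs a b c σ := by
  unfold SingleDir
  constructor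
  · intro h x hx
    have := h x hx
    simp only [openTo_join_iff hβ hx] at this
    exact this
  · intro h x hx
    have := h x hx
    simp only [openTo_join_iff hβ hx]
    exact this

end Transfer

/-! ### The table -/

section Table

/-- **The (★)-weight table**: signature bits `(ca, cb, lk)` and base events `(P, Q, B, CK, CL)`
(`P = c ~_H a` avoiding `L₀`, `Q = c ~_H b` avoiding `K₀`, `B = a ~_H b`, `CK = c ~_H a`,
`CL = c ~_H b`, all in the base). -/
def tbl (ca cb lk P Q B CK CL : Bool) : ℤ :=
  (if ca || P then 1 else 0) + (if cb || Q then 1 else 0) -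
    (if (B || lk) || ((CK || ca) && (CL || cb)) then 1 else 0)

/-- The truncated table: the four signatures that carry the inequality. -/
def tblLow (s : Bool × Bool × Bool) (P Q B CK CL : Bool) : ℤ :=
  (if s = (false, false, false) then 1 else 0) * tbl false false false P Q B CK CL +
    (if s = (false, false, true) then 1 else 0) * tbl false false true P Q B CK CL +
      (if s = (true, false, false) then 1 else 0) * tbl true false false P Q B CK CL +
        (if s = (false, true, false) then 1 else 0) * tbl false true false P Q B CK CL

/-- The table dominates its truncation (the other four signatures have nonnegative weight). -/
theorem tblLow_le_tbl (s : Bool × Bool × Bool) (P Q B CK CL : Bool) :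
    tblLow s P Q B CK CL ≤ tbl s.1 s.2.1 s.2.2 P Q B CK CL := by
  revert s P Q B CK CL
  decide

/-- `g₁₀₀ ≥ 0`. -/
theorem tbl_100_nonneg (P Q B CK CL : Bool) : 0 ≤ tbl true false false P Q B CK CL := by
  revert P Q B CK CL
  decide

/-- `g₀₁₀ ≥ 0`. -/
theorem tbl_010_nonneg (P Q B CK CL : Bool) : 0 ≤ tbl false true false P Q B CK CL := by
  revert P Q B CK CL
  decide

/-- **The key Boolean inequality** `g₀₀₁ + g₁₀₀ + g₀₁₀ ≥ g₀₀₀`. -/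
theorem tbl_sum_ge (P Q B CK CL : Bool) :
    tbl false false false P Q B CK CL ≤
      tbl false false true P Q B CK CL + tbl true false false P Q B CK CL +
        tbl false true false P Q B CK CL := by
  revert P Q B CK CL
  decide

end Table

end MultiGraph

end PercRepro
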